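import Literature.NumberTheory.EllipticCurves.Rank1Residual.ClassX1KellerYinTypeA
import Literature.NumberTheory.EllipticCurves.Wuthrich2014.ShaBoundProofs
import HarnessLib

/-!
# Class X1, analytic rank 1: Keller–Yin's display with the auxiliary field GIVEN, and the partner
# input discharged by a per-curve certificate `p ∤ #Ш(E^K)_an` (Wuthrich 2014, Prop. 21)

HONEST FRAMING (cell `b2b-bsdres`, home `run/shared/lean/b2b/bsd-rank1-residual/`): the goal of the
cell is to DELETE the COMBINATION-SHAPED residual classes of the BSD formula for ALL analytic-rank
`≤ 1` curves over `ℚ` from PUBLISHED theorems only, and to TYPE what is not published; this is not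
"finishing BSD". Keller–Yin arXiv:2402.12781v2 is an UNREFEREED PREPRINT and enters below only as
the explicit hypothesis `hKY_OPEN` (the `∀`-form of `KellerYin2024.thm421_rankOne_display_OPEN`).

`Proofs`-style file (theorems only: no definition, no new named fact), sequel of
`ClassX1KellerYin.lean` (prover x1a, gen 1: the rank-one assembly with the admissible field produced
from Hoffstein–Luo and the partner input `hpartner` quantified over ALL admissible fields),
`ClassX1KellerYinTypeA.lean` (partner discharged on parity type A by Greenberg–Vatsal) and
`ClassX1KellerYinPartner.lean` (type B: partner needs Mazur's (MC) on the type-A locus, not in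
print). What this file adds (prover x1a, gen 2):

* `pPart_of_bsdp`, `pPartRankZero_of_pPart` — the converses of the print-shape bridges of
  `PrintShapeTorsion.lean`: Miller's `BSD(E,p)` gives back the print shape `PPart W p` in analytic
  rank `≤ 1`, and `PPart` gives the rank-zero shape when `ord_{s=1} L(E,s) = 0` (bookkeeping:
  `Reg = 1`, `L^{(0)}(E,1) = L(E,1)`, `#Ш(p)` vs `#Ш` for finite `Ш`).
* `pPartRankZero_of_padicValRat_shaAn_eq_zero` — **the per-curve partner certificate**: at an odd
  prime `p`, not additive, with `ρ̄_{E,p}` reducible or surjective, `L(E,1) ≠ 0` and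
  `ord_p #Ш(E)_an = 0`, the rank-zero print shape holds (Wuthrich 2014 Prop. 21 pinches
  `ord_p #Ш` to `0`: x1b's `Wuthrich2014.bsdp_of_L_one_ne_zero_of_padicValRat_shaAn_eq_zero`, then
  the converses above).
* `bsdp_of_classX1_of_analyticRank_eq_one_of_KY_OPEN_at` — gen 1's rank-one assembly with the
  admissible imaginary quadratic field `K` ([CGLS] Thm. 5.3.1 (a)–(d): `d_K` odd, `d_K < -4`, Heegner
  for `N_E` and for `p`, `L(E^K,1) ≠ 0`) GIVEN rather than produced, and the partner input asked
  ONLY for that `K`: `PPartRankZero Wd p` for one globally minimal model `Wd` of `E^{(d_K)}`.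
* `bsdp_of_classX1_of_analyticRank_eq_one_of_KY_OPEN_of_twist_shaAn_unit` — **the lane's lever for
  the type-B half of X1 ∩ {r = 1}**: `ClassX1 W p`, `r_an = 1`, an admissible `K` and the numerical
  certificate `ord_p #Ш(E^{(d_K)})_an = 0` for ITS twist ⇒ `BSD(E,p)`, from `hKY_OPEN` and the
  PUBLISHED named facts `sha_dvd_analyticSha` (Wuthrich 2014 Prop. 21), `exists_isNewformOf`
  (modularity), `GrossZagier1986_thm_I_7_3`, `rank_eq_analyticRank_of_analyticRank_le_one` (GZK).
  No parity hypothesis: on type A the certificate is not needed (`ClassX1KellerYinTypeA`), on type B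
  it replaces the unprinted Mazur (MC) of the type-A partner by a per-pair computation — the exact
  analogue, for the partner, of the rank-`0` lever L1 of the census (`ClassX1.lean`,
  `bsdp_of_classX1_of_L_one_ne_zero`). The twist `E^K` is reducible at `p`
  (`not_hasIrreducibleModPGaloisRep_twist`), good ordinary at `p`
  (`isOrdinaryAt_of_smul_eq_quadraticTwist`, `p ∤ d_K` as `p` splits), so Prop. 21 applies to it.

Dictionary for the lane (bsdN): for a rank-`1` X1 pair `(E,p)` of type B (gvpar(E)), choose ANY
`K = ℚ(√d_K)` with `d_K ≡ 1 (mod 4)` negative, `d_K < -4`, every `ℓ ∣ N` split, `p` split,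
`L(E^{(d_K)},1) ≠ 0`, and certify `ord_p #Ш_an(E^{(d_K)}) = 0`; then `BSD(E,p)` is conditional on
Keller–Yin's Thms. 3.0.11 + 7.0.6 ALONE (as for type A).

## References
* T. Keller, M. Yin, arXiv:2402.12781v2 (2024), Thm. 4.2.1 and its proof (p. 22). [KellerYin2024]
* F. Castella, G. Grossi, J. Lee, C. Skinner, Invent. Math. 227 (2022), Thm. 5.3.1, (5.5)–(5.7). [CastellaEtAl2021]
* C. Wuthrich, Doc. Math. 19 (2014) 381–402, Prop. 21. [Wuthrich2014]
* R. L. Miller, LMS J. Comput. Math. 14 (2011), Def. 1.1. [Miller2011LMS]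
-/

set_option autoImplicit false

noncomputable section

open scoped Classical MatrixGroups ModularForm

open CongruenceSubgroup WeierstrassCurve Literature.NumberTheory.EllipticCurves
  Literature.NumberTheory.EllipticCurves.ModularForms Literature.NumberTheory.QuadraticFields

namespace Literature.NumberTheory.EllipticCurves.Rank1Residual

/-! ### Converses of the print-shape bridges -/

/-- **Miller's `BSD(E,p)` gives back the print shape** in analytic rank `≤ 1`: if `BSDp W p` holds
(`#Ш_an = q ∈ ℚ` with `ord_p q = ord_p #Ш(p)`), then `L^{(r)}(E,1)/(r!·Ω·Reg)` is the rational
`q · ∏ c_ℓ / #E(ℚ)_tors²` of valuation `ord_p #Ш + ord_p ∏ c_ℓ − 2 ord_p #E(ℚ)_tors` (`Ш` finite by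
Gross–Zagier–Kolyvagin `hGZK`, so `ord_p #Ш(p) = ord_p #Ш`; `q ≠ 0` by `L^{(r)}(E,1) ≠ 0` under
modularity `hmod`). Bookkeeping converse of `bsdp_of_pPart`.
[cite: Miller2011LMS, §1 and Def. 1.1 (arXiv:1010.2431 p. 3)] -/
theorem pPart_of_bsdp (hmod : hasEntireLFunction_rat)
    (hGZK : rank_eq_analyticRank_of_analyticRank_le_one)
    (W : WeierstrassCurve ℚ) [W.IsElliptic] [W.IsGloballyMinimal] (p : ℕ) [Fact p.Prime]
    (hr : W.analyticRank ≤ 1) (h : BSDp W p) : PPart W p := by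
  obtain ⟨-, hfin⟩ := hGZK W hr
  haveI : Finite W.sha := hfin
  obtain ⟨-, -, q, hq, hv⟩ := h
  -- positivity of the denominators
  have hΩ : (0 : ℝ) < W.realPeriodRat := W.realPeriodRat_pos_holds
  have hR : (0 : ℝ) < W.regulator := W.regulator_pos'
  have hc0 : 0 < W.tamagawaProduct := W.tamagawaProduct_pos_holds
  have ht0 : 0 < W.torsionOrder := W.torsionOrder_pos_holds
  have hΩ' : (W.realPeriodRat : ℂ) ≠ 0 := by exact_mod_cast hΩ.ne'
  have hR' : (W.regulator : ℂ) ≠ 0 := by exact_mod_cast hR.ne'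
  have hcp : (W.tamagawaProduct : ℂ) ≠ 0 := by exact_mod_cast hc0.ne'
  have htp : (W.torsionOrder : ℂ) ≠ 0 := by exact_mod_cast ht0.ne'
  -- `q ≠ 0` from `L^{(r)}(E,1) ≠ 0`
  have hLne : W.leadingLCoeff ≠ 0 := W.leadingLCoeff_ne_zero_holds (hmod W)
  have hq0 : q ≠ 0 := by
    rintro rfl
    rw [shaAn_def, Rat.cast_zero, div_eq_zero_iff] at hq
    rcases hq with h | h
    · exact mul_ne_zero hLne (pow_ne_zero 2 htp) h
    · exact mul_ne_zero (mul_ne_zero hΩ' hcp) hR' h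
  refine ⟨q * (W.tamagawaProduct : ℚ) / (W.torsionOrder : ℚ) ^ 2, ?_, ?_⟩
  · -- `L^{(r)}(E,1)/(Ω·Reg) = q · ∏ c_ℓ / #E(ℚ)_tors²`
    have hL : W.leadingLCoeff = (q : ℂ) * ((W.realPeriodRat : ℂ) * (W.tamagawaProduct : ℂ) *
        (W.regulator : ℂ)) / (W.torsionOrder : ℂ) ^ 2 := by
      rw [← hq, shaAn_def]
      field_simp
    rw [hL]
    push_cast
    field_simp
  · -- valuations
    have ht : (W.torsionOrder : ℚ) ≠ 0 := by exact_mod_cast ht0.ne'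
    have hc : (W.tamagawaProduct : ℚ) ≠ 0 := by exact_mod_cast hc0.ne'
    rw [padicValRat.div (mul_ne_zero hq0 hc) (pow_ne_zero 2 ht), padicValRat.mul hq0 hc,
      padicValRat.pow (W.torsionOrder : ℚ), padicValRat.of_nat, padicValRat.of_nat, hv,
      WeierstrassCurve.shaOrder, padicValNat_card_addPrimaryComponent]
    ring

/-- The general print shape gives the rank-zero one when `ord_{s=1} L(E,s) = 0`: `Reg(E/ℚ) = 1`
(`rank E(ℚ) = 0` by Gross–Zagier–Kolyvagin `hGZK`) and `L^{(0)}(E,1)/0! = L(E,1)`. Bookkeeping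
converse of `pPart_of_pPartRankZero`. [cite: Darmon2004, Thm. 3.22] -/
theorem pPartRankZero_of_pPart (hGZK : rank_eq_analyticRank_of_analyticRank_le_one)
    (W : WeierstrassCurve ℚ) [W.IsElliptic] [W.IsGloballyMinimal] (p : ℕ) [Fact p.Prime]
    (hr : W.analyticRank = 0) (h : PPart W p) : PPartRankZero W p := by
  obtain ⟨q, hq, hv⟩ := h
  have hrank : W.mordellWeilRank = 0 := by
    have := (hGZK W (by omega)).1
    omega
  refine ⟨q, ?_, hv⟩
  rw [W.regulator_eq_one_of_rank_zero hrank, mul_one, leadingLCoeff_eq_of_analyticRank_eq_zero W hr]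
    at hq
  exact hq

/-- **The per-curve partner certificate.** At an odd prime `p` which is not of additive reduction
and at which `ρ̄_{E,p}` is reducible or surjective, for `E/ℚ` (globally minimal `W`) with
`L(E,1) ≠ 0`: if `#Ш(E/ℚ)_an` is a rational of `p`-adic valuation `0` (a numerical certificate),
then the rank-zero print shape `PPartRankZero W p` holds — Wuthrich 2014 Prop. 21 gives
`ord_p #Ш ≤ ord_p #Ш_an = 0` (`Wuthrich2014.bsdp_of_L_one_ne_zero_of_padicValRat_shaAn_eq_zero`),
i.e. `BSD(E,p)`, and the converses above return the shape. [cite: Wuthrich2014, Prop. 21 (p. 400)]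
[cite: Miller2011LMS, Def. 1.1] -/
theorem pPartRankZero_of_padicValRat_shaAn_eq_zero (hW : Wuthrich2014.sha_dvd_analyticSha)
    (hmod : hasEntireLFunction_rat) (hGZK : rank_eq_analyticRank_of_analyticRank_le_one)
    (W : WeierstrassCurve ℚ) [W.IsElliptic] [W.IsGloballyMinimal] (p : ℕ) [Fact p.Prime]
    (hp : p ≠ 2) (hL : W.entireLFunction 1 ≠ 0)
    (hadd : ¬ ((W.baseChange ℚ_[p]).minimal ℤ_[p]).HasAdditiveReduction ℤ_[p])
    (himg : ¬ W.HasIrreducibleModPGaloisRep p ∨ W.HasSurjectiveModNGaloisRep p)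
    (hunit : ∃ q : ℚ, shaAn W = (q : ℂ) ∧ padicValRat p q = 0) :
    PPartRankZero W p := by
  have hr : W.analyticRank = 0 := analyticRank_eq_zero_of_entireLFunction_one_ne_zero hL
  have hB : BSDp W p :=
    Wuthrich2014.bsdp_of_L_one_ne_zero_of_padicValRat_shaAn_eq_zero hW hGZK W p hp hL hadd himg hunit
  exact pPartRankZero_of_pPart hGZK W p hr (pPart_of_bsdp hmod hGZK W p (by omega) hB)

/-! ### Rank 1 with the auxiliary field given -/

/-- **X1 ∩ {r = 1} along Keller–Yin's printed proof, auxiliary field GIVEN.** As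
`bsdp_of_classX1_of_analyticRank_eq_one_of_KY_OPEN` (gen 1), but the imaginary quadratic `K` of
[CGLS] Thm. 5.3.1 (a)–(d) — `d_K` odd, `d_K < -4`, every prime of `N_E` split, `p` split,
`L(E^K,1) ≠ 0` — is a hypothesis, and the partner input is asked only for ONE globally minimal model
`Wd` of the twist `E^{(d_K)}`: `PPartRankZero Wd p` ([CGLS] Thm. 5.1.4 for `E^K`). PUBLISHED inputs:
modularity (`hmod`), Gross–Zagier I.7.3 (`hGZ`), Gross–Zagier–Kolyvagin (`hGZK`). OPEN: `hKY_OPEN`,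
the rank-one display of Keller–Yin's proof of Thm. 4.2.1 (p. 22), `∀`-form of
`KellerYin2024.thm421_rankOne_display_OPEN` (unpublished links: KY Thms. 3.0.11, 7.0.6).
Proof: `q = L'(E,1)/(Ω Reg)` by Gross–Zagier; `qd = L(E^K,1)/Ω_{E^K}` with its valuation from the
partner shape; the display gives `PPart W p`; `bsdp_of_pPart` concludes.
[cite: KellerYin2024, Thm. 4.2.1 and its proof (p. 22)] [cite: CastellaEtAl2021, Thm. 5.3.1 and its proof] -/
theorem bsdp_of_classX1_of_analyticRank_eq_one_of_KY_OPEN_at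
    (W : WeierstrassCurve ℚ) [W.IsElliptic] [W.IsGloballyMinimal] (p : ℕ) [Fact p.Prime]
    (hX1 : ClassX1 W p) (hr : W.analyticRank = 1)
    (hmod : exists_isNewformOf) (hGZ : GrossZagier1986_thm_I_7_3)
    (hGZK : rank_eq_analyticRank_of_analyticRank_le_one)
    (hKY_OPEN : ∀ (W' : WeierstrassCurve ℚ) [W'.IsElliptic] [W'.IsGloballyMinimal] (p' : ℕ)
        [Fact p'.Prime], p' ≠ 2 → W'.HasGoodReductionAtPrime p' → ¬ W'.HasIrreducibleModPGaloisRep p' →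
        W'.analyticRank = 1 →
      ∀ (K : Type) [Field K] [NumberField K], IsImaginaryQuadratic K →
        Odd (NumberField.discr K) → NumberField.discr K < -4 →
        SatisfiesHeegnerHypothesis (W'.conductorNorm ℤ) K → SatisfiesHeegnerHypothesis p' K →
        (W'.quadraticTwist (NumberField.discr K : ℚ)).entireLFunction 1 ≠ 0 →
      ∀ (Wd : WeierstrassCurve ℚ) [Wd.IsElliptic] [Wd.IsGloballyMinimal],
        (∃ C : VariableChange ℚ, C • Wd = W'.quadraticTwist (NumberField.discr K : ℚ)) →
      ∀ (q qd : ℚ), W'.leadingLCoeff / ((W'.realPeriodRat * W'.regulator : ℝ) : ℂ) = (q : ℂ) →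
        Wd.entireLFunction 1 / (Wd.realPeriodRat : ℂ) = (qd : ℂ) →
        padicValRat p' q - ((padicValNat p' W'.shaOrder : ℤ) + padicValNat p' W'.tamagawaProduct -
            2 * padicValNat p' W'.torsionOrder) =
          -(padicValRat p' qd - ((padicValNat p' Wd.shaOrder : ℤ) + padicValNat p' Wd.tamagawaProduct -
            2 * padicValNat p' Wd.torsionOrder)))
    (K : Type) [Field K] [NumberField K] (hK : IsImaginaryQuadratic K)
    (hodd : Odd (NumberField.discr K)) (hlt : NumberField.discr K < -4)
    (hHN : SatisfiesHeegnerHypothesis (W.conductorNorm ℤ) K) (hHp : SatisfiesHeegnerHypothesis p K)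
    (hLK : (W.quadraticTwist (NumberField.discr K : ℚ)).entireLFunction 1 ≠ 0)
    (Wd : WeierstrassCurve ℚ) [Wd.IsElliptic] [Wd.IsGloballyMinimal]
    (hWd : ∃ C : VariableChange ℚ, C • Wd = W.quadraticTwist (NumberField.discr K : ℚ))
    (hpartner : PPartRankZero Wd p) :
    BSDp W p := by
  -- the class: `p ≠ 2`, good reduction, `E[p]` reducible (anomaly is not used by the deduction)
  have hp2 : p ≠ 2 := by have := hX1.1; omega
  have hgood : W.HasGoodReductionAtPrime p := hX1.2.2.1
  have hred : ¬ W.HasIrreducibleModPGaloisRep p := hX1.2.1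
  -- `q = L'(E,1)/(Ω·Reg) ∈ ℚ` (Gross–Zagier), `rank E(ℚ) = 1` (Kolyvagin)
  obtain ⟨hrank, -⟩ := hGZK W (by omega)
  have hrk : W.mordellWeilRank = 1 := by omega
  obtain ⟨q, -, hqL⟩ := leadingLCoeff_eq_rat_mul_of_analyticRank_eq_one (W := W) hGZ hr hrk
  have hΩ : (0 : ℝ) < W.realPeriodRat := W.realPeriodRat_pos_holds
  have hR : (0 : ℝ) < W.regulator := W.regulator_pos'
  have hΩR : ((W.realPeriodRat * W.regulator : ℝ) : ℂ) ≠ 0 := by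
    exact_mod_cast (mul_pos hΩ hR).ne'
  have hq : W.leadingLCoeff / ((W.realPeriodRat * W.regulator : ℝ) : ℂ) = (q : ℂ) := by
    rw [div_eq_iff hΩR, hqL]
    push_cast
    ring
  -- `qd = L(E^K,1)/Ω_{E^K}` with its valuation (the partner shape)
  obtain ⟨qd, hqd, hvd⟩ := hpartner
  -- Keller–Yin's display for THIS `K`
  have hdisp := hKY_OPEN W p hp2 hgood hred hr K hK hodd hlt hHN hHp hLK Wd hWd q qd hq hqd
  have hv : padicValRat p q = (padicValNat p W.shaOrder : ℤ) + padicValNat p W.tamagawaProduct -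
      2 * padicValNat p W.torsionOrder := by
    rw [hvd] at hdisp
    linarith
  -- the print shape, then Miller's `BSD(E,p)`
  exact bsdp_of_pPart W p (WeierstrassCurve.hasEntireLFunction_rat_of_exists_isNewformOf hmod) hGZK
    (by omega) ⟨q, hq, hv⟩

/-- **X1 ∩ {r = 1} ⇒ `BSD(E,p)` modulo Keller–Yin's display and a per-pair certificate on ONE
twist** (the lever for the type-B half; no parity hypothesis). Let `W/ℚ` be globally minimal
elliptic, `ClassX1 W p`, `ord_{s=1} L(E,s) = 1`; let `K` be an admissible imaginary quadratic field
([CGLS] Thm. 5.3.1 (a)–(d): `d_K` odd, `d_K < -4`, Heegner for `N_E` and for `p`, `L(E^K,1) ≠ 0`) and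
`Wd` a globally minimal model of `E^{(d_K)}` with the CERTIFICATE `ord_p #Ш(E^{(d_K)})_an = 0`
(`hunit`; `#Ш_an = shaAn Wd`, Miller 2011 §1). PUBLISHED named facts: `sha_dvd_analyticSha`
(Wuthrich 2014 Prop. 21), `exists_isNewformOf` (modularity), `GrossZagier1986_thm_I_7_3`,
`rank_eq_analyticRank_of_analyticRank_le_one` (Gross–Zagier–Kolyvagin); tree theorems: the twist is
reducible at `p` (`not_hasIrreducibleModPGaloisRep_twist`) and has good reduction at `p`
(`isOrdinaryAt_of_smul_eq_quadraticTwist`; `d_K` square-free as `d_K ≡ 1 (mod 4)`, `p ∤ d_K` as `p`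
splits), hence is not additive there, and `L` is invariant under the change of model. OPEN:
`hKY_OPEN` only (Keller–Yin Thms. 3.0.11 + 7.0.6, arXiv:2402.12781v2). For `E` of parity type A the
certificate is superfluous (`bsdp_of_classX1_typeA_of_analyticRank_eq_one_of_KY_OPEN`); for type B it
stands in for Mazur's (MC) at the type-A partner (`ClassX1KellerYinPartner`), per pair.
[cite: KellerYin2024, Thm. 4.2.1 and its proof (p. 22)] [cite: Wuthrich2014, Prop. 21 (p. 400)]
[cite: CastellaEtAl2021, Thm. 5.3.1 and its proof] -/
theorem bsdp_of_classX1_of_analyticRank_eq_one_of_KY_OPEN_of_twist_shaAn_unit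
    (hW : Wuthrich2014.sha_dvd_analyticSha)
    (W : WeierstrassCurve ℚ) [W.IsElliptic] [W.IsGloballyMinimal] (p : ℕ) [Fact p.Prime]
    (hX1 : ClassX1 W p) (hr : W.analyticRank = 1)
    (hmod : exists_isNewformOf) (hGZ : GrossZagier1986_thm_I_7_3)
    (hGZK : rank_eq_analyticRank_of_analyticRank_le_one)
    (hKY_OPEN : ∀ (W' : WeierstrassCurve ℚ) [W'.IsElliptic] [W'.IsGloballyMinimal] (p' : ℕ)
        [Fact p'.Prime], p' ≠ 2 → W'.HasGoodReductionAtPrime p' → ¬ W'.HasIrreducibleModPGaloisRep p' →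
        W'.analyticRank = 1 →
      ∀ (K : Type) [Field K] [NumberField K], IsImaginaryQuadratic K →
        Odd (NumberField.discr K) → NumberField.discr K < -4 →
        SatisfiesHeegnerHypothesis (W'.conductorNorm ℤ) K → SatisfiesHeegnerHypothesis p' K →
        (W'.quadraticTwist (NumberField.discr K : ℚ)).entireLFunction 1 ≠ 0 →
      ∀ (Wd : WeierstrassCurve ℚ) [Wd.IsElliptic] [Wd.IsGloballyMinimal],
        (∃ C : VariableChange ℚ, C • Wd = W'.quadraticTwist (NumberField.discr K : ℚ)) →
      ∀ (q qd : ℚ), W'.leadingLCoeff / ((W'.realPeriodRat * W'.regulator : ℝ) : ℂ) = (q : ℂ) →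
        Wd.entireLFunction 1 / (Wd.realPeriodRat : ℂ) = (qd : ℂ) →
        padicValRat p' q - ((padicValNat p' W'.shaOrder : ℤ) + padicValNat p' W'.tamagawaProduct -
            2 * padicValNat p' W'.torsionOrder) =
          -(padicValRat p' qd - ((padicValNat p' Wd.shaOrder : ℤ) + padicValNat p' Wd.tamagawaProduct -
            2 * padicValNat p' Wd.torsionOrder)))
    (K : Type) [Field K] [NumberField K] (hK : IsImaginaryQuadratic K)
    (hodd : Odd (NumberField.discr K)) (hlt : NumberField.discr K < -4)
    (hHN : SatisfiesHeegnerHypothesis (W.conductorNorm ℤ) K) (hHp : SatisfiesHeegnerHypothesis p K)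
    (hLK : (W.quadraticTwist (NumberField.discr K : ℚ)).entireLFunction 1 ≠ 0)
    (Wd : WeierstrassCurve ℚ) [Wd.IsElliptic] [Wd.IsGloballyMinimal]
    (hWd : ∃ C : VariableChange ℚ, C • Wd = W.quadraticTwist (NumberField.discr K : ℚ))
    (hunit : ∃ q : ℚ, shaAn Wd = (q : ℂ) ∧ padicValRat p q = 0) :
    BSDp W p := by
  have hp : p.Prime := Fact.out
  have hp2 : p ≠ 2 := by have := hX1.1; omega
  have hgood : W.HasGoodReductionAtPrime p := hX1.2.2.1
  have hred : ¬ W.HasIrreducibleModPGaloisRep p := hX1.2.1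
  have hord : ¬ (p : ℤ) ∣ W.frobeniusTrace p :=
    KellerYin2024.not_dvd_frobeniusTrace_of_anomalous W p hX1.2.2.2.1.2.2
  obtain ⟨C, hC⟩ := hWd
  have hd0 : (NumberField.discr K : ℚ) ≠ 0 := by
    exact_mod_cast (show NumberField.discr K ≠ 0 by omega)
  have hsqf : Squarefree (NumberField.discr K) := squarefree_discr_of_odd hK hodd
  have hpd : ¬ (p : ℤ) ∣ NumberField.discr K := not_dvd_discr_of_split hK hp hp2 hHp
  -- the twist: good (ordinary) at `p`, hence not additive; reducible at `p`; `L(E^K,1) ≠ 0`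
  obtain ⟨hgood_d, -⟩ :=
    isOrdinaryAt_of_smul_eq_quadraticTwist W Wd hsqf hC p hp2 hpd ⟨hgood, hord⟩
  have hadd_d : ¬ ((Wd.baseChange ℚ_[p]).minimal ℤ_[p]).HasAdditiveReduction ℤ_[p] :=
    WeierstrassCurve.HasGoodReduction.not_hasAdditiveReduction (R := ℤ_[p]) hgood_d
  have hred_d : ¬ Wd.HasIrreducibleModPGaloisRep p :=
    not_hasIrreducibleModPGaloisRep_twist hred hd0 Wd C hC
  have hLd : Wd.entireLFunction 1 ≠ 0 := by
    rw [← Wd.entireLFunction_smul C, hC]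
    exact hLK
  -- the partner shape from the certificate (Wuthrich Prop. 21)
  have hpartner : PPartRankZero Wd p :=
    pPartRankZero_of_padicValRat_shaAn_eq_zero hW
      (WeierstrassCurve.hasEntireLFunction_rat_of_exists_isNewformOf hmod) hGZK Wd p hp2 hLd hadd_d
      (Or.inl hred_d) hunit
  exact bsdp_of_classX1_of_analyticRank_eq_one_of_KY_OPEN_at W p hX1 hr hmod hGZ hGZK hKY_OPEN K hK
    hodd hlt hHN hHp hLK Wd ⟨C, hC⟩ hpartner

end Literature.NumberTheory.EllipticCurves.Rank1Residual

end
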